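import Summits.Ventures.DiscreteObjects.PP12.FlagTenDataFin
import Summits.Ventures.DiscreteObjects.PP12.FlagTenConjunctR3
import Summits.Ventures.DiscreteObjects.PP12.FlagTenConjunctsColouring

/-!
# `IsFlagTenOrbitMatrix` for the data of a plane: conjunct 8 ((R3), two T-line orbits) (kernel; Step E transport)
Framing: lottery ticket; floor = certified bounds/negative ranges.

Cell pub-namedobj (venture DiscreteObjects), target (M), designs gen 13 (HOME FAMILY-FLAG7X §7b). For `D = flagTenDataOfPlane …` (`FlagTenDataFin`):
`∀ k ≠ k', ∀ t t', #{i : D.C k i = t ∧ D.C k' i = t'} + #{j : D.β k j t = D.β k' j t'} = 3` — transported from `FlagTenConjunctR3.tline_pair_count`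
via `FlagTenConjunctsColouring.card_filter_eTri` (triangles) and `card_filter_eFixL` (fixed lines, this file). No `sorry`, no new axioms.
-/

namespace Summit.Ventures.DiscreteObjects.PP12

open Configuration Finset
open scoped Classical

namespace Collineation

variable {P L : Type*} [Membership P L] [ProjectivePlane P L] [Fintype P] [Fintype L] (σ : Collineation P L)

section Data

variable {l : L} {c : P} (hl : σ.onLines l = l) (hc : σ.onPoints c = c) (hcl : c ∈ l)
  (hP : ∀ p : P, σ.onPoints p = p → p ∈ l) (hL : ∀ m : L, σ.onLines m = m → c ∈ m) (h12 : ProjectivePlane.order P L = 12)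
  (hq : σ.onPoints ^ 3 = 1) (hf : fixedCard σ.onPoints = 10) {u₀ : L} (hcu₀ : c ∈ u₀) (hu₀ : σ.onLines u₀ ≠ u₀)

/-- Transport of a count along `eFixL`: a `Fin 9`-filter defined through `(eFixL j).1` has the cardinality of the corresponding filter of fixed
lines `≠ l`. -/
theorem card_filter_eFixL (p : L → Prop) :
    (univ.filter fun j : Fin 9 => p (σ.eFixL hl hc hf j).1).card = (univ.filter fun m : L => σ.onLines m = m ∧ m ≠ l ∧ p m).card := by
  set e := σ.eFixL hl hc hf
  refine Finset.card_bij (fun j _ => (e j).1) (fun j hj => ?_) (fun j₁ _ j₂ _ h => ?_) (fun m hm => ?_)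
  · rw [mem_filter] at hj ⊢; exact ⟨mem_univ _, (e j).2.1, (e j).2.2, hj.2⟩
  · exact e.injective (Subtype.ext h)
  · rw [mem_filter] at hm
    refine ⟨e.symm ⟨m, hm.2.1, hm.2.2.1⟩, ?_, ?_⟩
    · rw [mem_filter]; refine ⟨mem_univ _, ?_⟩; rw [Equiv.apply_symm_apply]; exact hm.2.2.2
    · rw [Equiv.apply_symm_apply]

/-- **Conjunct 8 ((R3)):** two T-line orbits through different fixed points meet the right number of common triangles and T-orbits. -/
theorem flagTenDataOfPlane_R3 (k k' : Fin 9) (t t' : Fin 4) (hkk' : k ≠ k') :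
    (univ.filter fun i : Fin 12 => (σ.flagTenDataOfPlane hl hc hcl hP hL h12 hq hf hcu₀ hu₀).C k i = t ∧
        (σ.flagTenDataOfPlane hl hc hcl hP hL h12 hq hf hcu₀ hu₀).C k' i = t').card
      + (univ.filter fun j : Fin 9 => (σ.flagTenDataOfPlane hl hc hcl hP hL h12 hq hf hcu₀ hu₀).β k j t =
          (σ.flagTenDataOfPlane hl hc hcl hP hL h12 hq hf hcu₀ hu₀).β k' j t').card = 3 := by
  set D := σ.flagTenDataOfPlane hl hc hcl hP hL h12 hq hf hcu₀ hu₀ with hD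
  set e := eTri (P := P) h12 hcu₀ with he
  set eJ := σ.eFixL hl hc hf with heJ
  set y := σ.eFixP hl hc hf k with hy
  set y' := σ.eFixP hl hc hf k' with hy'
  set eB := σ.eLOrb hl hcl hP hL h12 hq y with heB
  set eB' := σ.eLOrb hl hcl hP hL h12 hq y' with heB'
  have hyy' : y.1 ≠ y'.1 := fun h => hkk' ((σ.eFixP hl hc hf).injective (Subtype.ext h))
  -- representatives of the two line orbits
  obtain ⟨b, hb, hbeq⟩ := mem_image.1 (eB t).2
  obtain ⟨b', hb', hb'eq⟩ := mem_image.1 (eB' t').2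
  rw [mem_filter] at hb hb'
  -- unfold C and β
  have hC : ∀ i : Fin 12, D.C k i = eB.symm ⟨σ.cOrb l y.1 (e i).1,
      (σ.cOrb_mem hl hP (σ.exterior_of_mem_cline hL hcu₀ hu₀ (e i).2.1 (e i).2.2) y.2.1).1⟩ := fun i => rfl
  have hC' : ∀ i : Fin 12, D.C k' i = eB'.symm ⟨σ.cOrb l y'.1 (e i).1,
      (σ.cOrb_mem hl hP (σ.exterior_of_mem_cline hL hcu₀ hu₀ (e i).2.1 (e i).2.2) y'.2.1).1⟩ := fun i => rfl
  have hβ : ∀ j : Fin 9, ∀ (kk : Fin 9) (tt : Fin 4), D.β kk j tt = (σ.eOrbOn hc hcl hP hL h12 hq (eJ j)).symm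
      ⟨σ.betaOrb c (eJ j).1 ((σ.eLOrb hl hcl hP hL h12 hq (σ.eFixP hl hc hf kk)) tt).1, by
          obtain ⟨b₁, hb₁, hb₁eq⟩ := mem_image.1 ((σ.eLOrb hl hcl hP hL h12 hq (σ.eFixP hl hc hf kk)) tt).2
          rw [mem_filter] at hb₁
          rw [← hb₁eq]
          exact σ.betaOrb_mem hc hcl hP hL hq (σ.eFixP hl hc hf kk).2.1 (σ.eFixP hl hc hf kk).2.2 hb₁.2.1 hb₁.2.2
            (eJ j).2.1 (eJ j).2.2⟩ := fun j kk tt => rfl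
  -- the first filter
  have hset1 : (univ.filter fun i : Fin 12 => D.C k i = t ∧ D.C k' i = t')
      = univ.filter fun i : Fin 12 => σ.cOrb l y.1 (e i).1 = orb3 σ.onLines b ∧ σ.cOrb l y'.1 (e i).1 = orb3 σ.onLines b' := by
    ext i; simp only [mem_filter, mem_univ, true_and, hC, hC']
    constructor
    · rintro ⟨h1, h2⟩
      constructor
      · have := congrArg (fun s => (eB s).1) h1; simp at this; rw [this, hbeq]
      · have := congrArg (fun s => (eB' s).1) h2; simp at this; rw [this, hb'eq]
    · rintro ⟨h1, h2⟩
      constructor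
      · apply eB.injective; rw [Equiv.apply_symm_apply]; apply Subtype.ext; change σ.cOrb l y.1 (e i).1 = (eB t).1; rw [h1, hbeq]
      · apply eB'.injective; rw [Equiv.apply_symm_apply]; apply Subtype.ext; change σ.cOrb l y'.1 (e i).1 = (eB' t').1; rw [h2, hb'eq]
  -- the second filter
  have hset2 : (univ.filter fun j : Fin 9 => D.β k j t = D.β k' j t')
      = univ.filter fun j : Fin 9 => σ.betaOrb c (eJ j).1 (orb3 σ.onLines b) = σ.betaOrb c (eJ j).1 (orb3 σ.onLines b') := by
    ext j; simp only [mem_filter, mem_univ, true_and, hβ]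
    rw [← hy, ← hy', ← heB, ← heB']
    constructor
    · intro h
      have := congrArg Subtype.val ((σ.eOrbOn hc hcl hP hL h12 hq (eJ j)).symm.injective h)
      simp only at this; rw [hbeq, hb'eq]; exact this
    · intro h
      congr 1; apply Subtype.ext; change σ.betaOrb c (eJ j).1 (eB t).1 = σ.betaOrb c (eJ j).1 (eB' t').1
      rw [← hbeq, ← hb'eq]; exact h
  rw [hset1, hset2]
  have h1 := card_filter_eTri h12 hcu₀ (fun x => σ.cOrb l y.1 x = orb3 σ.onLines b ∧ σ.cOrb l y'.1 x = orb3 σ.onLines b')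
  rw [← he] at h1
  have h2 := σ.card_filter_eFixL hl hc hf (fun m => σ.betaOrb c m (orb3 σ.onLines b) = σ.betaOrb c m (orb3 σ.onLines b'))
  rw [← heJ] at h2
  have h3 := σ.tline_pair_count hl hc hcl hP hL h12 hq hf hcu₀ hu₀ y.2.1 y.2.2 y'.2.1 y'.2.2 hyy' hb.2.1 hb.2.2 hb'.2.1 hb'.2.2
  have h4 : (univ.filter fun x : P => x ∈ u₀ ∧ x ≠ c ∧ (σ.cOrb l y.1 x = orb3 σ.onLines b ∧ σ.cOrb l y'.1 x = orb3 σ.onLines b')).card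
      + (univ.filter fun m : L => σ.onLines m = m ∧ m ≠ l ∧
          σ.betaOrb c m (orb3 σ.onLines b) = σ.betaOrb c m (orb3 σ.onLines b')).card = 3 := by
    convert h3 using 3
  rw [← h4]
  congr 1
  · convert h1 using 2 <;> (ext x; simp only [mem_filter, mem_univ, true_and])
  · convert h2 using 2 <;> (ext x; simp only [mem_filter, mem_univ, true_and])

end Data

end Collineation

end Summit.Ventures.DiscreteObjects.PP12
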